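/-
Copyright (c) 2026 the pub-hodgecm-mathlib formalisation cell (harness21).  Prover seat hodgecm-mathlib-K2Liu-p10 (g0), Track B «K2-LIT»,
#184♮ = hLiu418 = `stmt-HodgeConjecture-24832`; SIGS-RoadI-v3 §Hol (the (E2) bridge of the adelic Hol.3(c) sentence).
THEOREMS ONLY (no `def`, no `instance`, no named-fact hypothesis, no `sorry`).
-/
import Summits.HodgeConjecture.HodgeConjecture.Theorems.K2LiuSiegelUnipotentLocalDefs
import Literature.NumberTheory.Automorphic.UnitaryGroupArchToAdelicPlaces
import Literature.NumberTheory.Automorphic.UnitaryGroupArchimedeanPlaces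
import HarnessLib

/-!
# Crux `HLiu418`, Road I: `N_Δ(L⁺ ⊗ ℝ)` read PLACE BY PLACE — `a ∈ unipDeltaArch ↔ ∀ w, IsUnipM (a_w)`

Cell `hodgecm-mathlib`, crux item hLiu418 = `stmt-HodgeConjecture-24832` (helper lane, count-neutral).  The archimedean twin of
★ `K2LiuSiegelUnipotentLocalDefs.mem_unipDeltaFin_iff_isUnipM ∕ isUnipM_iff_forall_place`:
* §1 `isUnipM_mixed_iff_forall`: over `L ⊗ ℝ = mixedSpace L` (no real places: `c` fixes every infinite place) the three block
  equations of ★ `IsUnipM` hold iff they hold at every complex place (`M.map (evalC w)`);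
* §2 `isUnipM_coe_archToAdelic_iff`: for `a ∈ H_∞`, the adelic matrix of `(a, 1) = archToAdelic a` is `IsUnipM` iff the matrix of `a`
  over `L ⊗ ℝ` is (★ `map_fst∕snd_coe_archToAdelic`, ★ `isUnipM_iff_fst_snd`); hence `mem_unipDeltaArch_iff_isUnipM`;
* §3 **`mem_unipDeltaArch_iff_forall_archAt`**: `a ∈ N_Δ(L⁺ ⊗ ℝ)` iff `IsUnipM (archAt w a)` for every complex place `w` — the
  reading needed to turn left-`N_Δ(𝔸)`-invariance of `F = W_0 F` into Hol-2b's (E2) through the per-place frames of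
  ★ `K2LiuHermitianTubeFrameArch{,Inv}` (`IsUnipM ↔` hermitian translation, onto).
Sources: [BorelJacquet1979, §4.1]; [MoeglinWaldspurger1995, I.2.1].
HONEST LABEL.  Helper lemmas, count-neutral; `HC_CM` is proved only modulo the 7 printed citations (2 remaining named inputs:
hLiu418 = `stmt-HodgeConjecture-24832`, h413 = `stmt-HodgeConjecture-24833`) until rung 0 closes.
-/

set_option autoImplicit false
set_option linter.dupNamespace false -- the mandated namespace repeats `HodgeConjecture.HodgeConjecture`

namespace Summit.HodgeConjecture.HodgeConjecture.Cruxes.HLiu418.K2LiuSiegelUnipotentArchPlaces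

open Matrix NumberField NumberField.InfinitePlace NumberField.mixedEmbedding IsDedekindDomain
open scoped MatrixGroups
open Literature.NumberTheory.Automorphic Literature.NumberTheory.Automorphic.UnitaryGroup
open Literature.NumberTheory.GelbartRogawski1991 Literature.NumberTheory.GelbartRogawski1991.GRConstruction
open K2LiuSiegelUnipotentLocalDefs

variable (L : Type) [Field L] [NumberField L] [IsCMField L] {N M n : ℕ} (e : Fin N × Fin M ≃ Fin n)
  (dV : Fin N → L) (hdV : ∀ i, IsCMField.complexConj L (dV i) = dV i)
  (dW : Fin M → L) (hdW : ∀ i, IsCMField.complexConj L (dW i) = dW i)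

/-! ## 1. `IsUnipM` over `L ⊗ ℝ` is checked place by place -/

/-- **`IsUnipM` over `mixedSpace L` iff at every complex place** (a CM field has no real place). [cite: BorelJacquet1979, §4.1] -/
theorem isUnipM_mixed_iff_forall (M : Matrix (Fin (n + n)) (Fin (n + n)) (mixedSpace L)) :
    IsUnipM (n := n) M ↔ ∀ w : {w : InfinitePlace L // w.IsComplex}, IsUnipM (n := n) (M.map (evalC L w)) := by
  refine ⟨fun h w => h.map (n := n) _, fun h => ?_⟩
  have hfix : ∀ w : InfinitePlace L, IsCMField.complexConj L • w = w := UnitaryGroup.complexConj_smul_infinitePlace L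
  have key : ∀ A B : Matrix (Fin n) (Fin n) (mixedSpace L),
      (∀ w : {w : InfinitePlace L // w.IsComplex}, A.map (evalC L w) = B.map (evalC L w)) → A = B := by
    intro A B hAB
    refine Matrix.ext fun i j => ?_
    exact mixedSpace_ext (Fp L) L (IsCMField.complexConj L) (IsCMField.complexConj_ne_one L) hfix fun w =>
      congrFun (congrFun (hAB w) i) j
  unfold IsUnipM at h ⊢
  have hw : ∀ w : {w : InfinitePlace L // w.IsComplex},
      ((Matrix.reindex (e₂ (n := n)).symm (e₂ (n := n)).symm M).toBlocks₁₁ +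
          (Matrix.reindex (e₂ (n := n)).symm (e₂ (n := n)).symm M).toBlocks₁₂).map (evalC L w) = (1 : Matrix _ _ _).map (evalC L w) ∧
      ((Matrix.reindex (e₂ (n := n)).symm (e₂ (n := n)).symm M).toBlocks₂₁ +
          (Matrix.reindex (e₂ (n := n)).symm (e₂ (n := n)).symm M).toBlocks₂₂).map (evalC L w) = (1 : Matrix _ _ _).map (evalC L w) ∧
      ((Matrix.reindex (e₂ (n := n)).symm (e₂ (n := n)).symm M).toBlocks₂₂ -
          (Matrix.reindex (e₂ (n := n)).symm (e₂ (n := n)).symm M).toBlocks₁₂).map (evalC L w) = (1 : Matrix _ _ _).map (evalC L w) := by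
    intro w
    obtain ⟨h1, h2, h3⟩ := h w
    have k := toBlocks_reindex_e₂_map (n := n) (evalC L w : mixedSpace L → ℂ) M
    rw [k.1, k.2.1, k.2.2.1, k.2.2.2] at *
    rw [Matrix.map_add _ (map_add _), Matrix.map_add _ (map_add _), Matrix.map_sub _ (map_sub _),
      Matrix.map_one _ (map_zero _) (map_one _)]
    exact ⟨h1, h2, h3⟩
  exact ⟨key _ _ fun w => (hw w).1, key _ _ fun w => (hw w).2.1, key _ _ fun w => (hw w).2.2⟩

/-! ## 2. `(a, 1) ∈ N_Δ(𝔸)` iff the matrix of `a` is `IsUnipM` -/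

/-- Transport of `IsUnipM` along a ring equivalence (both directions). [cite: MoeglinWaldspurger1995, I.2.1] -/
theorem isUnipM_map_ringEquiv_iff {R S : Type*} [CommRing R] [CommRing S] (f : R ≃+* S)
    (M : Matrix (Fin (n + n)) (Fin (n + n)) R) : IsUnipM (n := n) (M.map f.toRingHom) ↔ IsUnipM (n := n) M := by
  refine ⟨fun h => ?_, fun h => h.map (n := n) _⟩
  have h' := h.map (n := n) f.symm.toRingHom
  rwa [Matrix.map_map, show (⇑f.symm.toRingHom ∘ ⇑f.toRingHom) = id from funext fun x => f.symm_apply_apply x,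
    Matrix.map_id] at h'

/-- **For `a ∈ H_∞`: the adelic matrix of `(a, 1)` is `IsUnipM` iff the matrix of `a` over `L ⊗ ℝ` is.** [cite: BorelJacquet1979, §4.1] -/
theorem isUnipM_coe_archToAdelic_iff
    (a : UnitaryGroup.arch (Fp L) L (IsCMField.complexConj L) (n + n) (hermD L e dV hdV dW hdW)) :
    IsUnipM (n := n) (((UnitaryGroup.archToAdelic (Fp L) L (IsCMField.complexConj L) (n + n) (hermD L e dV hdV dW hdW) a).1 :
        Matrix (Fin (n + n)) (Fin (n + n)) (AdeleRing (𝓞 L) L))) ↔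
      IsUnipM (n := n) ((a : GL (Fin (n + n)) (mixedSpace L)) : Matrix (Fin (n + n)) (Fin (n + n)) (mixedSpace L)) := by
  have h := isUnipM_iff_fst_snd (n := n) (R := InfiniteAdeleRing L) (S := FiniteAdeleRing (𝓞 L) L)
    (((UnitaryGroup.archToAdelic (Fp L) L (IsCMField.complexConj L) (n + n) (hermD L e dV hdV dW hdW) a).1 :
        GL (Fin (n + n)) (AdeleRing (𝓞 L) L)) : Matrix (Fin (n + n)) (Fin (n + n)) (AdeleRing (𝓞 L) L))
  refine h.trans ?_
  have hfst := UnitaryGroup.map_fst_coe_archToAdelic (Fp L) L (IsCMField.complexConj L) (n + n) (hermD L e dV hdV dW hdW) a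
  have hsnd := UnitaryGroup.map_snd_coe_archToAdelic (Fp L) L (IsCMField.complexConj L) (n + n) (hermD L e dV hdV dW hdW) a
  change IsUnipM (n := n) (Matrix.map _ (adeleFst L)) ∧ IsUnipM (n := n) (Matrix.map _ (adeleSnd L)) ↔ _
  rw [hfst, hsnd, isUnipM_map_ringEquiv_iff]
  exact ⟨fun k => k.1, fun k => ⟨k, isUnipM_one⟩⟩

/-- **`a ∈ N_Δ(L⁺ ⊗ ℝ)` iff the matrix of `a` over `L ⊗ ℝ` is `IsUnipM`.** [cite: BorelJacquet1979, §4.1] -/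
theorem mem_unipDeltaArch_iff_isUnipM
    (a : UnitaryGroup.arch (Fp L) L (IsCMField.complexConj L) (n + n) (hermD L e dV hdV dW hdW)) :
    a ∈ unipDeltaArch L e dV hdV dW hdW ↔
      IsUnipM (n := n) ((a : GL (Fin (n + n)) (mixedSpace L)) : Matrix (Fin (n + n)) (Fin (n + n)) (mixedSpace L)) :=
  ((mem_unipDeltaArch_iff L e dV hdV dW hdW a).trans (mem_unipDelta_iff_isUnipM L e dV hdV dW hdW _)).trans
    (isUnipM_coe_archToAdelic_iff L e dV hdV dW hdW a)

/-! ## 3. Place by place -/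

/-- The matrix of the place component `archAt w a` is the `evalC w`-image of the matrix of `a`. [cite: BorelJacquet1979, §4.1] -/
theorem coe_archAt_eq_map (w : {w : InfinitePlace L // w.IsComplex}) (hw : IsCMField.complexConj L • w.1 = w.1)
    (a : UnitaryGroup.arch (Fp L) L (IsCMField.complexConj L) (n + n) (hermD L e dV hdV dW hdW)) :
    (((UnitaryGroup.archAt (Fp L) L (IsCMField.complexConj L) (n + n) (hermD L e dV hdV dW hdW) w hw
        (IsCMField.complexConj_ne_one L) a : UnitaryGroup.archLocal L (n + n) (hermD L e dV hdV dW hdW) w) :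
          GL (Fin (n + n)) ℂ) : Matrix (Fin (n + n)) (Fin (n + n)) ℂ) =
      ((a : GL (Fin (n + n)) (mixedSpace L)) : Matrix (Fin (n + n)) (Fin (n + n)) (mixedSpace L)).map (evalC L w) := by
  ext i j
  rw [UnitaryGroup.coe_archAt_apply, Matrix.map_apply, evalC_apply]

/-- **`a ∈ N_Δ(L⁺ ⊗ ℝ)` iff `IsUnipM (a_w)` at every complex place `w`.** [cite: BorelJacquet1979, §4.1] -/
theorem mem_unipDeltaArch_iff_forall_archAt
    (a : UnitaryGroup.arch (Fp L) L (IsCMField.complexConj L) (n + n) (hermD L e dV hdV dW hdW)) :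
    a ∈ unipDeltaArch L e dV hdV dW hdW ↔
      ∀ w : {w : InfinitePlace L // w.IsComplex},
        IsUnipM (n := n) (((UnitaryGroup.archAt (Fp L) L (IsCMField.complexConj L) (n + n) (hermD L e dV hdV dW hdW) w
          (UnitaryGroup.complexConj_smul_infinitePlace L w.1) (IsCMField.complexConj_ne_one L) a :
            UnitaryGroup.archLocal L (n + n) (hermD L e dV hdV dW hdW) w) : GL (Fin (n + n)) ℂ) : Matrix (Fin (n + n)) (Fin (n + n)) ℂ) := by
  rw [mem_unipDeltaArch_iff_isUnipM, isUnipM_mixed_iff_forall]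
  refine forall_congr' fun w => ?_
  rw [coe_archAt_eq_map]

end Summit.HodgeConjecture.HodgeConjecture.Cruxes.HLiu418.K2LiuSiegelUnipotentArchPlaces
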